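import Literature.NumberTheory.LFunctions.HardyZRiemannSiegelEvaluation
import Literature.NumberTheory.LFunctions.RiemannSiegelRemainderK0
import HarnessLib

/-!
# The Riemann–Siegel evaluator of Hardy's `Z` with a PROVED remainder bound (no named fact)

Topic `Literature/NumberTheory/LFunctions` (with `Analysis/ValidatedNumerics`). The evaluator
`Literature.NumberTheory.LFunctions.RSEval.hardyZBox` (`HardyZRiemannSiegelEvaluation.lean`) encloses
`Z(t)` by Gabcke's formula (6) with `K = 0`, taking the remainder bound
`|R₀(t)| < 0.127 t^{−3/4}` (Gabcke 1979, Satz 3.2.2 (b)) as the NAMED FACT `Gabcke.satz322b_R0`.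
The tree now PROVES an explicit (weaker) bound for the same remainder,
`Literature.NumberTheory.LFunctions.Gabcke.abs_R0_le_explicit_of_ge` (`RiemannSiegelRemainderK0.lean`,
Gabcke's direct `K = 0` route): for `t ≥ 8`, `a = √(t/2π) ∉ ℤ` and `cos πz ≠ 0`,

  `|R₀(t)| ≤ (2/√a)(√2 · S'(a) + (2K(¼)/t)(√2/4)e^{π/4})`,

`S'(a)` an explicit rational function of `a` with coefficients in `ℚ(√2, √(3/10), π, 2^{1/4})`.
This file

1. rewrites that bound as `u · (c₁/a + c₂/a² + c₃/a³ + c₄/a⁴ + c₅/a⁵ + (2K(¼)/t) c_θ)`, `u = a^{−1/2}`,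
   with six closed-form constants `c₁ = 0.2281…`, `c₂ = 0.0626…`, `c₃ = 0.0557…`, `c₄ = 0.0078…`,
   `c₅ = 59.95…`, `c_θ = √2 e^{π/4}/2 = 1.5508…` (`Gabcke.abs_R0_le_cpoly`, ONE ring identity — no
   real-number numerics), i.e. `≈ 0.906 t^{−3/4} + 3.50 t^{−5/4} + …`;
2. builds the constants once as intervals (`RSEval.RSTablesX`, `RSEval.rsTablesXWith`) from
   `log 2`, `log 3`, `log 10`, `π`, and
3. gives the evaluator **`RSEval.hardyZBoxX`** — `hardyZBox` with the remainder term
   `± 0.127 e^{−(3/4) log t}` replaced by the interval value of the proved bound (≈ 12 interval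
   multiplications more per sample) — and its soundness **`RSEval.mem_hardyZBoxX`**, which has NO
   named-fact hypothesis: `hardyZBoxX X p e N = some B → Z(p/2^e) ∈ B` for valid tables
   (`a ∉ ℤ` at dyadic `t` is `Gabcke.int_ne_a_dyadic`; `cos πz ≠ 0` is checked by `FBox` as before).

Consumer: `RiemannHypothesisUpToRSCertificateExplicit.lean` (run checker without `Gabcke.satz322b_R0`),
which turns the tree's heights `RiemannHypothesisUpTo 10⁵` (compiled) and `10³` (kernel) unconditional.

## References

* W. Gabcke, *Neue Herleitung und explizite Restabschätzung der Riemann-Siegel-Formel*,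
  Dissertation, Göttingen 1979: Einleitung (1), (6) pp. 2–3; §3.1 Satz 3.1.3; Satz 3.2.2 p. 55. [Gabcke1979]
* H. M. Edwards, *Riemann's Zeta Function*, 1974, §7. [Edwards1974]
-/

open Finset Complex
open Literature.Analysis.ValidatedNumerics Literature.Analysis.ValidatedNumerics.NumericsMP
open Literature.NumberTheory.LFunctions Literature.NumberTheory.LFunctions.ZetaNumerics
open scoped Real

namespace Literature.NumberTheory.LFunctions

/-! ## 1. The proved remainder bound as a polynomial in `1/a` -/

namespace Gabcke

/-- `c₁ = 2√2 (7√2√(3/10)/(40π) + √2/(12π)) = 0.22814…`, the coefficient of `a^{−3/2}` in the proved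
bound (`≈ 0.906 t^{−3/4}`), written with `P = 1/π` in the shape the interval evaluator uses.
[cite: Gabcke1979, §3.1 Satz 3.1.3] -/
noncomputable def cX1 : ℝ :=
  Real.sqrt 2 * (2 : ℤ) * (Real.sqrt 2 * Real.sqrt (3 / 10) * (1 / π) * (7 : ℤ) / (40 : ℕ)
    + Real.sqrt 2 * (1 / π) / (12 : ℕ))

/-- `c₂ = 2√2 (33/(400π²) + (6 + 5√2)/(96π²)) = 0.06266…` (coefficient of `a^{−5/2}`).
[cite: Gabcke1979, §3.1 Satz 3.1.3] -/
noncomputable def cX2 : ℝ :=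
  Real.sqrt 2 * (2 : ℤ) * ((1 / π) * (1 / π) * (33 : ℤ) / (400 : ℕ)
    + ((6 : ℤ) + Real.sqrt 2 * (5 : ℤ)) * ((1 / π) * (1 / π)) / (96 : ℕ))

/-- `c₃ = 2√2 (79QY/(2000π²) + (56Q + 75)/(3840π²))`, `Q = (2+√2)√2`, `Y = √(3/10)`; `= 0.05571…`
(coefficient of `a^{−7/2}`). [cite: Gabcke1979, §3.1 Satz 3.1.3] -/
noncomputable def cX3 : ℝ :=
  Real.sqrt 2 * (2 : ℤ) * (((2 : ℤ) + Real.sqrt 2) * Real.sqrt 2 * Real.sqrt (3 / 10) * ((1 / π) * (1 / π))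
      * (79 : ℤ) / (2000 : ℕ)
    + (((2 : ℤ) + Real.sqrt 2) * Real.sqrt 2 * (56 : ℤ) + (75 : ℤ)) * ((1 / π) * (1 / π)) / (3840 : ℕ))

/-- `c₄ = 2√2 · 17Q/(960π³) = 0.00779…` (coefficient of `a^{−9/2}`). [cite: Gabcke1979, §3.1 Satz 3.1.3] -/
noncomputable def cX4 : ℝ :=
  Real.sqrt 2 * (2 : ℤ) * (((2 : ℤ) + Real.sqrt 2) * Real.sqrt 2 * ((1 / π) * (1 / π) * (1 / π))
    * (17 : ℤ) / (960 : ℕ))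

/-- `c₅ = 2√2 · 7680 κ/π⁵ = 59.95…`, `κ = 2^{1/4}/2 + 1/4` (coefficient of `a^{−11/2}`, from the
elementary bound `1/(2 sinh(πa/2)) ≤ 3840/(π⁵a⁵)` of the far part). [cite: Gabcke1979, §3.1 Satz 3.1.3] -/
noncomputable def cX5 : ℝ :=
  Real.sqrt 2 * (2 : ℤ) * ((Real.exp (Real.log 2 / (4 : ℕ)) / (2 : ℕ) + (1 : ℤ) / (4 : ℕ))
    * ((1 / π) * (1 / π) * (1 / π) * ((1 / π) * (1 / π))) * (7680 : ℤ))

/-- `c_θ = √2 e^{π/4}/2 = 1.5508…`, the factor of `2K(¼)/t` (the tree's Stirling bound for `ϑ`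
enters the remainder through the phase of the saddle-point term). [cite: Gabcke1979, §3.2 Satz 3.2.2] -/
noncomputable def cXθ : ℝ := Real.sqrt 2 * Real.exp (π / (4 : ℕ)) / (2 : ℕ)

/-- **The proved `K = 0` remainder bound in evaluator form**: for `t ≥ 8` with `a = √(t/2π) ∉ ℤ` and
`cos πz ≠ 0`, with `u = (√a)⁻¹` and `w = u·u = 1/a`,
`|R₀(t)| ≤ u (c₁ w + c₂ w² + c₃ w³ + c₄ w⁴ + c₅ w⁵ + (2K(¼)/t) c_θ)` — the bound of
`Gabcke.abs_R0_le_explicit_of_ge` regrouped by powers of `a` (a ring identity).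
[cite: Gabcke1979, §3.2 Satz 3.2.2] -/
theorem abs_R0_le_cpoly {t : ℝ} (ht : 8 ≤ t) (hai : ∀ n : ℤ, (n : ℝ) ≠ Gabcke.a t)
    (hcos : Real.cos (π * Gabcke.z t) ≠ 0) :
    |R0 t| ≤ (Real.sqrt (Gabcke.a t))⁻¹ *
      (cX1 * ((Real.sqrt (Gabcke.a t))⁻¹ * (Real.sqrt (Gabcke.a t))⁻¹)
        + cX2 * (((Real.sqrt (Gabcke.a t))⁻¹ * (Real.sqrt (Gabcke.a t))⁻¹)
            * ((Real.sqrt (Gabcke.a t))⁻¹ * (Real.sqrt (Gabcke.a t))⁻¹))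
        + cX3 * (((Real.sqrt (Gabcke.a t))⁻¹ * (Real.sqrt (Gabcke.a t))⁻¹)
            * ((Real.sqrt (Gabcke.a t))⁻¹ * (Real.sqrt (Gabcke.a t))⁻¹)
            * ((Real.sqrt (Gabcke.a t))⁻¹ * (Real.sqrt (Gabcke.a t))⁻¹))
        + cX4 * (((Real.sqrt (Gabcke.a t))⁻¹ * (Real.sqrt (Gabcke.a t))⁻¹)
            * ((Real.sqrt (Gabcke.a t))⁻¹ * (Real.sqrt (Gabcke.a t))⁻¹)
            * ((Real.sqrt (Gabcke.a t))⁻¹ * (Real.sqrt (Gabcke.a t))⁻¹)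
            * ((Real.sqrt (Gabcke.a t))⁻¹ * (Real.sqrt (Gabcke.a t))⁻¹))
        + cX5 * (((Real.sqrt (Gabcke.a t))⁻¹ * (Real.sqrt (Gabcke.a t))⁻¹)
            * ((Real.sqrt (Gabcke.a t))⁻¹ * (Real.sqrt (Gabcke.a t))⁻¹)
            * ((Real.sqrt (Gabcke.a t))⁻¹ * (Real.sqrt (Gabcke.a t))⁻¹)
            * ((Real.sqrt (Gabcke.a t))⁻¹ * (Real.sqrt (Gabcke.a t))⁻¹)
            * ((Real.sqrt (Gabcke.a t))⁻¹ * (Real.sqrt (Gabcke.a t))⁻¹))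
        + 2 * stirlingVertRate (1 / 4) / t * cXθ) := by
  have ht0 : (0 : ℝ) < t := by linarith
  have hA : 0 < Gabcke.a t := Real.sqrt_pos.2 (div_pos ht0 (by positivity))
  set A := Gabcke.a t with hAdef
  set s := Real.sqrt A with hsdef
  have hs : 0 < s := Real.sqrt_pos.2 hA
  have hs2 : s * s = A := Real.mul_self_sqrt hA.le
  have hw : s⁻¹ * s⁻¹ = A⁻¹ := by rw [← mul_inv, hs2]
  rw [hw]
  refine (abs_R0_le_explicit_of_ge ht hai hcos).trans (le_of_eq ?_)
  rw [← hAdef, ← hsdef]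
  have hpi : π ≠ 0 := Real.pi_ne_zero
  have hA0 : A ≠ 0 := hA.ne'
  unfold kerIntegralBound cX1 cX2 cX3 cX4 cX5 cXθ
  push_cast
  field_simp
  ring

end Gabcke

/-! ## 2. Tables with the six constants -/

namespace RSEval

/-- Riemann–Siegel tables together with interval enclosures of the six constants of the proved
remainder bound (`Gabcke.cX1 … cX5`, `Gabcke.cXθ`). [cite: Gabcke1979, §3.2 Satz 3.2.2] -/
structure RSTablesX where
  /-- the Riemann–Siegel tables (scale, `π`, logarithms, magnitudes, `log 2`, `log π`, `2K(¼)`) -/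
  R : RSTables
  /-- `∋ c₁` -/
  c1 : MI
  /-- `∋ c₂` -/
  c2 : MI
  /-- `∋ c₃` -/
  c3 : MI
  /-- `∋ c₄` -/
  c4 : MI
  /-- `∋ c₅` -/
  c5 : MI
  /-- `∋ c_θ` -/
  cθ : MI

/-- Validity of `RSTablesX`: valid Riemann–Siegel tables and correct enclosures of the constants.
[cite: Gabcke1979, §3.2 Satz 3.2.2] -/
structure RSTablesX.Valid (X : RSTablesX) : Prop where
  R_valid : X.R.Valid
  mem_c1 : MI.mem X.R.T.S Gabcke.cX1 X.c1
  mem_c2 : MI.mem X.R.T.S Gabcke.cX2 X.c2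
  mem_c3 : MI.mem X.R.T.S Gabcke.cX3 X.c3
  mem_c4 : MI.mem X.R.T.S Gabcke.cX4 X.c4
  mem_c5 : MI.mem X.R.T.S Gabcke.cX5 X.c5
  mem_cθ : MI.mem X.R.T.S Gabcke.cXθ X.cθ

/-- Attach the six constants to Riemann–Siegel tables `R`: `√2 = e^{(log 2)/2}`,
`√(3/10) = e^{(log 3 − log 10)/2}`, `2^{1/4} = e^{(log 2)/4}`, `e^{π/4}`, `1/π` by the interval
`exp`/`log`/division of the tree, then the polynomial expressions of `Gabcke.cX1 … cXθ`. [folklore] -/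
def mkRSTablesX (R : RSTables) : Option RSTablesX :=
  let S := R.T.S
  match MI.exp S R.T.Kexp R.T.kexp (R.log2.divNat 2), logNatK S R.Klog 3, logNatK S R.Klog 10,
      MI.exp S R.T.Kexp R.T.kexp (R.log2.divNat 4), MI.exp S R.T.Kexp R.T.kexp (R.T.piI.divNat 4),
      MI.divPos S (MI.ofInt S 1) R.T.piI with
  | some x, some l3, some l10, some q4, some e4, some ip =>
    match MI.exp S R.T.Kexp R.T.kexp ((l3.sub l10).divNat 2) with
    | some y =>
      let ip2 := MI.mul S ip ip
      let ip3 := MI.mul S ip2 ip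
      let ip5 := MI.mul S ip3 ip2
      let Q := MI.mul S ((MI.ofInt S 2).add x) x
      let κ := (q4.divNat 2).add (MI.ofFrac S 1 4)
      let twoX := x.mulInt 2
      some ⟨R,
        MI.mul S twoX ((((MI.mul S (MI.mul S x y) ip).mulInt 7).divNat 40).add
          ((MI.mul S x ip).divNat 12)),
        MI.mul S twoX (((ip2.mulInt 33).divNat 400).add
          ((MI.mul S ((MI.ofInt S 6).add (x.mulInt 5)) ip2).divNat 96)),
        MI.mul S twoX ((((MI.mul S (MI.mul S Q y) ip2).mulInt 79).divNat 2000).add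
          ((MI.mul S ((Q.mulInt 56).add (MI.ofInt S 75)) ip2).divNat 3840)),
        MI.mul S twoX (((MI.mul S Q ip3).mulInt 17).divNat 960),
        MI.mul S twoX ((MI.mul S κ ip5).mulInt 7680),
        (MI.mul S x e4).divNat 2⟩
    | none => none
  | _, _, _, _, _, _ => none

/-- Soundness of `mkRSTablesX` (inclusion property of the interval operations building the constants of
the remainder bound of Gabcke's (6), `K = 0`). [cite: Gabcke1979, Einleitung (6) p. 3] -/
theorem mkRSTablesX_valid {R : RSTables} (hR : R.Valid) {X : RSTablesX} (h : mkRSTablesX R = some X) :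
    X.Valid := by
  have hS := hR.T_valid.S_pos
  have hpi := hR.T_valid.mem_pi
  unfold mkRSTablesX at h
  simp only at h
  split at h
  · rename_i x l3 l10 q4 e4 ip hx hl3 hl10 hq4 he4 hip
    split at h
    · rename_i y hy
      simp only [Option.some.injEq] at h
      subst h
      -- the atoms
      have hx' : MI.mem R.T.S (Real.sqrt 2) x := by
        have := MI.mem_exp hS hx (MI.mem_divNat hR.mem_log2 (n := 2) (by norm_num))
        convert this using 1
        rw [Real.sqrt_eq_rpow, Real.rpow_def_of_pos (by norm_num : (0:ℝ) < 2)]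
        congr 1; push_cast; ring
      rw [logNatK_eq] at hl3 hl10
      have hl3' := MI.mem_logNat hS hl3
      have hl10' := MI.mem_logNat hS hl10
      have hy' : MI.mem R.T.S (Real.sqrt (3 / 10)) y := by
        have := MI.mem_exp hS hy (MI.mem_divNat (MI.mem_sub hl3' hl10') (n := 2) (by norm_num))
        convert this using 1
        rw [Real.sqrt_eq_rpow, Real.rpow_def_of_pos (by norm_num : (0:ℝ) < 3 / 10),
          Real.log_div (by norm_num) (by norm_num)]
        congr 1; push_cast; ring
      have hq4' : MI.mem R.T.S (Real.exp (Real.log 2 / (4 : ℕ))) q4 :=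
        MI.mem_exp hS hq4 (MI.mem_divNat hR.mem_log2 (n := 4) (by norm_num))
      have he4' : MI.mem R.T.S (Real.exp (π / (4 : ℕ))) e4 :=
        MI.mem_exp hS he4 (MI.mem_divNat hpi (n := 4) (by norm_num))
      have hip' : MI.mem R.T.S (1 / π) ip := by
        have := MI.mem_divPos hS hip (MI.mem_ofInt R.T.S 1) hpi
        simpa using this
      have hip2 := MI.mem_mul hS hip' hip'
      have hip3 := MI.mem_mul hS hip2 hip'
      have hip5 := MI.mem_mul hS hip3 hip2
      have hQ : MI.mem R.T.S (((2 : ℤ) + Real.sqrt 2) * Real.sqrt 2)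
          (MI.mul R.T.S ((MI.ofInt R.T.S 2).add x) x) :=
        MI.mem_mul hS (MI.mem_add (MI.mem_ofInt R.T.S 2) hx') hx'
      have hκ : MI.mem R.T.S (Real.exp (Real.log 2 / (4 : ℕ)) / (2 : ℕ) + (1 : ℤ) / (4 : ℕ))
          ((q4.divNat 2).add (MI.ofFrac R.T.S 1 4)) :=
        MI.mem_add (MI.mem_divNat hq4' (n := 2) (by norm_num)) (MI.mem_ofFrac R.T.S 1 (q := 4) (by norm_num))
      have h2X : MI.mem R.T.S (Real.sqrt 2 * (2 : ℤ)) (x.mulInt 2) := MI.mem_mulInt hx' 2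
      refine ⟨hR, ?_, ?_, ?_, ?_, ?_, ?_⟩
      · exact MI.mem_mul hS h2X (MI.mem_add
          (MI.mem_divNat (MI.mem_mulInt (MI.mem_mul hS (MI.mem_mul hS hx' hy') hip') 7)
            (n := 40) (by norm_num))
          (MI.mem_divNat (MI.mem_mul hS hx' hip') (n := 12) (by norm_num)))
      · exact MI.mem_mul hS h2X (MI.mem_add
          (MI.mem_divNat (MI.mem_mulInt hip2 33) (n := 400) (by norm_num))
          (MI.mem_divNat (MI.mem_mul hS (MI.mem_add (MI.mem_ofInt R.T.S 6) (MI.mem_mulInt hx' 5)) hip2)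
            (n := 96) (by norm_num)))
      · exact MI.mem_mul hS h2X (MI.mem_add
          (MI.mem_divNat (MI.mem_mulInt (MI.mem_mul hS (MI.mem_mul hS hQ hy') hip2) 79)
            (n := 2000) (by norm_num))
          (MI.mem_divNat (MI.mem_mul hS (MI.mem_add (MI.mem_mulInt hQ 56) (MI.mem_ofInt R.T.S 75)) hip2)
            (n := 3840) (by norm_num)))
      · exact MI.mem_mul hS h2X
          (MI.mem_divNat (MI.mem_mulInt (MI.mem_mul hS hQ hip3) 17) (n := 960) (by norm_num))
      · exact MI.mem_mul hS h2X (MI.mem_mulInt (MI.mem_mul hS hκ hip5) 7680)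
      · exact MI.mem_divNat (MI.mem_mul hS hx' he4') (n := 2) (by norm_num)
    · simp at h
  · simp at h

/-- `RSTablesX` at scale `2^60` for main sums of length `≤ N` (the parameters of `rsTablesWith`).
[folklore] -/
def rsTablesXWith (N : ℕ) : Option RSTablesX :=
  match rsTablesWith N with
  | some R => mkRSTablesX R
  | none => none

/-- Tables built by `rsTablesXWith` are valid (the data of Gabcke's (1)/(6) with the proved `K = 0`
remainder constants). [cite: Gabcke1979, Einleitung (6) p. 3] -/
theorem rsTablesXWith_valid {N : ℕ} {X : RSTablesX} (h : rsTablesXWith N = some X) : X.Valid := by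
  unfold rsTablesXWith at h
  split at h
  · rename_i R hR
    exact mkRSTablesX_valid (rsTablesWith_valid hR) h
  · simp at h

/-! ## 3. The evaluator with the proved remainder -/

/-- **The certified Riemann–Siegel evaluator of Hardy's `Z` with the PROVED remainder bound** at the
dyadic point `t = p/2^e` with claimed main-sum length `N` (checked: `2πN² < t < 2π(N+1)²`, `t ≥ 200`,
`1 ≤ N ≤` table size): as `hardyZBox`, an interval
`2 Re(e^{iϑ_m} W) ± ⌈2·(2K(¼)/t)·‖W‖⌉ + (−1)^{N+1} u F(z) ± g`, but with
`g = u (c₁ w + c₂ w² + c₃ w³ + c₄ w⁴ + c₅ w⁵ + (2K(¼)/t) c_θ)`, `u = e^{−L/4} = a^{−1/2}`, `w = u²`,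
the interval value of `Gabcke.abs_R0_le_cpoly`. [cite: Gabcke1979, Einleitung (6) p. 3] -/
def hardyZBoxX (X : RSTablesX) (p e N : ℕ) : Option MI :=
  let R := X.R
  let S := R.T.S
  let tI := MI.ofFrac S p (2 ^ e)
  if 200 * 2 ^ e ≤ p ∧ 1 ≤ N ∧ N ≤ R.T.N ∧
      (R.T.piI.mulInt ((2 * N * N : ℕ) : ℤ)).hi < tI.lo ∧
      tI.hi < (R.T.piI.mulInt ((2 * (N + 1) * (N + 1) : ℕ) : ℤ)).lo then
    match logT R p e, rsW R tI N with
    | some lt, some W =>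
      let L := (lt.sub R.log2).sub R.logPi
      let thm := (((MI.mul S tI L).sub tI).divNat 2).sub (R.T.piI.divNat 8)
      match MC.expI S R.T.KI R.T.kI R.T.piI thm, MI.divPos S R.twoK tI,
        MI.exp S R.T.Kexp R.T.kexp (L.divNat 2), MI.exp S R.T.Kexp R.T.kexp ((L.divNat 4).neg) with
      | some E, some dl, some aI, some ainv =>
        let main := ((MC.mul S E W).re).mulInt 2
        let rad : ℤ := Numerics.cdiv (2 * dl.hi * W.absHi) S
        let zI := (MI.ofInt S 1).sub ((aI.sub (MI.ofInt S N)).mulInt 2)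
        match FBox R zI with
        | some FI =>
          let c0 := (MI.mul S ainv FI).mulInt ((-1) ^ (N + 1))
          let w := MI.mul S ainv ainv
          let w2 := MI.mul S w w
          let w3 := MI.mul S w2 w
          let w4 := MI.mul S w3 w
          let w5 := MI.mul S w4 w
          let g := MI.mul S ainv ((((((MI.mul S X.c1 w).add (MI.mul S X.c2 w2)).add (MI.mul S X.c3 w3)).add
            (MI.mul S X.c4 w4)).add (MI.mul S X.c5 w5)).add (MI.mul S dl X.cθ))
          some (((main.widen rad).add c0).add ⟨-g.hi, g.hi⟩)
        | none => none
      | _, _, _, _ => none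
    | _, _ => none
  else none

/-! ## 4. Soundness -/

section Soundness

/-- `|2 Re(e^{iϑ} W) − 2 Re(e^{iφ} W)| ≤ 2 |ϑ − φ| ‖W‖`. [folklore] -/
private lemma abs_two_re_sub_le' (θ φ : ℝ) (W : ℂ) :
    |2 * (Complex.exp ((θ : ℂ) * I) * W).re - 2 * (Complex.exp ((φ : ℂ) * I) * W).re| ≤
      2 * |θ - φ| * ‖W‖ := by
  rw [← mul_sub, ← Complex.sub_re, ← sub_mul, abs_mul, abs_two, mul_assoc]
  gcongr
  refine (Complex.abs_re_le_norm _).trans ?_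
  rw [norm_mul]
  gcongr
  exact Numerics.CB.norm_exp_I_sub_exp_I_le θ φ

/-- `a = e^{L/2}` and `1/√a = e^{−L/4}` with `L = log(t/2π)`, `t > 0`. [folklore] -/
private lemma gabckeA_eq' {t : ℝ} (ht : 0 < t) :
    Gabcke.a t = Real.exp (Real.log (t / (2 * π)) / 2) ∧
      (Real.sqrt (Gabcke.a t))⁻¹ = Real.exp (-(Real.log (t / (2 * π)) / 4)) := by
  have hq : 0 < t / (2 * π) := by positivity
  have ha : Gabcke.a t = Real.exp (Real.log (t / (2 * π)) / 2) := by
    unfold Gabcke.a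
    rw [Real.sqrt_eq_rpow, Real.rpow_def_of_pos hq]
    congr 1; ring
  refine ⟨ha, ?_⟩
  rw [ha, Real.sqrt_eq_rpow, ← Real.exp_mul, ← Real.exp_neg]
  congr 1; ring

/-- **Soundness of the Riemann–Siegel evaluator with the proved remainder — no named fact.** For valid
tables, `hardyZBoxX X p e N = some B` implies `Z(p/2^e) ∈ B`. The remainder is controlled by
`Gabcke.abs_R0_le_cpoly` (`= abs_R0_le_explicit_of_ge`, proved in the tree), whose hypotheses hold:
`t ≥ 200 ≥ 8`, `√(t/2π) ∉ ℤ` at the dyadic `t` (`Gabcke.int_ne_a_dyadic`), and `cos πz ≠ 0` from the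
sign check inside `FBox`. [cite: Gabcke1979, Satz 3.2.2 p. 55] -/
theorem mem_hardyZBoxX {X : RSTablesX} (hX : X.Valid) {p e N : ℕ}
    {B : MI} (h : hardyZBoxX X p e N = some B) :
    MI.mem X.R.T.S (hardyZ ((p : ℝ) / 2 ^ e)) B := by
  have hR := hX.R_valid
  have hS := hR.T_valid.S_pos
  have hSr : (0 : ℝ) < X.R.T.S := by exact_mod_cast hS
  have hpi := hR.T_valid.mem_pi
  unfold hardyZBoxX at h
  simp only at h
  split_ifs at h with hc
  obtain ⟨h200, hN1, hNN, hlow, hupp⟩ := hc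
  -- the sample point
  set t : ℝ := (p : ℝ) / 2 ^ e with htdef
  have h2e : (0 : ℝ) < 2 ^ e := by positivity
  have ht200 : 200 ≤ t := by
    rw [htdef, le_div_iff₀ h2e]
    have : ((200 * 2 ^ e : ℕ) : ℝ) ≤ p := by exact_mod_cast h200
    push_cast at this
    exact this
  have ht0 : 0 < t := by linarith
  have hp1 : 1 ≤ p := by
    by_contra hp
    push Not at hp
    interval_cases p
    simp [htdef] at ht200; linarith
  have htI : MI.mem X.R.T.S t (MI.ofFrac X.R.T.S p (2 ^ e)) := by
    have := MI.mem_ofFrac X.R.T.S (p : ℤ) (q := 2 ^ e) (by positivity)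
    have e1 : ((p : ℤ) : ℝ) / ((2 ^ e : ℕ) : ℝ) = t := by rw [htdef]; push_cast; ring
    rwa [e1] at this
  -- `N = Gabcke.N t`
  have hlow' : 2 * π * (N : ℝ) ^ 2 < t := by
    have hm : MI.mem X.R.T.S (2 * π * (N : ℝ) ^ 2) (X.R.T.piI.mulInt ((2 * N * N : ℕ) : ℤ)) := by
      have := MI.mem_mulInt hpi ((2 * N * N : ℕ) : ℤ)
      convert this using 1; push_cast; ring
    exact MI.lt_of_hi_lt_lo hm htI hlow
  have hupp' : t < 2 * π * ((N : ℝ) + 1) ^ 2 := by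
    have hm : MI.mem X.R.T.S (2 * π * ((N : ℝ) + 1) ^ 2)
        (X.R.T.piI.mulInt ((2 * (N + 1) * (N + 1) : ℕ) : ℤ)) := by
      have := MI.mem_mulInt hpi ((2 * (N + 1) * (N + 1) : ℕ) : ℤ)
      convert this using 1; push_cast; ring
    exact MI.lt_of_hi_lt_lo htI hm hupp
  have hNeq : Gabcke.N t = N := gabckeN_eq hlow' hupp'
  split at h
  · rename_i lt W hlt hW
    split at h
    · rename_i E dl aI ainv hE hdl haI hainv
      split at h
      · rename_i FI hFI
        simp only [Option.some.injEq] at h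
        subst h
        -- enclosures
        have hlt' : MI.mem X.R.T.S (Real.log t) lt := by
          unfold logT at hlt
          split at hlt
          · rename_i lp hlp
            simp only [Option.some.injEq] at hlt
            subst hlt
            rw [logNatK_eq] at hlp
            have h1 := MI.mem_logNat hS hlp
            have h2 := MI.mem_mulInt hR.mem_log2 (e : ℤ)
            have := MI.mem_sub h1 h2
            convert this using 1
            have hp0 : (0 : ℝ) < p := by exact_mod_cast hp1
            rw [htdef, Real.log_div hp0.ne' (by positivity), Real.log_pow]
            push_cast
            ring
          · simp at hlt
        set Lr : ℝ := Real.log (t / (2 * π)) with hLr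
        have hL : MI.mem X.R.T.S Lr ((lt.sub X.R.log2).sub X.R.logPi) := by
          have := MI.mem_sub (MI.mem_sub hlt' hR.mem_log2) hR.mem_logPi
          convert this using 1
          rw [hLr, Real.log_div ht0.ne' (by positivity), Real.log_mul (by norm_num) Real.pi_pos.ne']
          ring
        set θm : ℝ := t / 2 * Real.log (t / (2 * π)) - t / 2 - π / 8 with hθm
        have hthm : MI.mem X.R.T.S θm ((((MI.mul X.R.T.S (MI.ofFrac X.R.T.S p (2 ^ e))
            ((lt.sub X.R.log2).sub X.R.logPi)).sub (MI.ofFrac X.R.T.S p (2 ^ e))).divNat 2).sub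
            (X.R.T.piI.divNat 8)) := by
          have := MI.mem_sub (MI.mem_divNat (MI.mem_sub (MI.mem_mul hS htI hL) htI) (n := 2)
            (by norm_num)) (MI.mem_divNat hpi (n := 8) (by norm_num))
          convert this using 1
          rw [hθm, hLr]; push_cast; ring
        have hE' := MC.mem_expI hS hpi hE hthm
        have hW' := mem_rsW hR htI N hNN hW
        have hdl' : MI.mem X.R.T.S (2 * stirlingVertRate (1 / 4) / t) dl :=
          MI.mem_divPos hS hdl hR.mem_twoK htI
        obtain ⟨haeq, hainveq⟩ := gabckeA_eq' ht0
        have haI' : MI.mem X.R.T.S (Gabcke.a t) aI := by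
          rw [haeq]
          exact MI.mem_exp hS haI (MI.mem_divNat hL (n := 2) (by norm_num))
        have hainv' : MI.mem X.R.T.S ((Real.sqrt (Gabcke.a t))⁻¹) ainv := by
          rw [hainveq]
          refine MI.mem_exp hS hainv ?_
          have := MI.mem_neg (MI.mem_divNat hL (n := 4) (by norm_num))
          convert this using 2
          rw [hLr]; push_cast; ring
        have hz : MI.mem X.R.T.S (Gabcke.z t)
            ((MI.ofInt X.R.T.S 1).sub ((aI.sub (MI.ofInt X.R.T.S N)).mulInt 2)) := by
          have := MI.mem_sub (MI.mem_ofInt X.R.T.S 1) (MI.mem_mulInt (MI.mem_sub haI'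
            (MI.mem_ofInt X.R.T.S (N : ℤ))) 2)
          have e1 : ((1 : ℤ) : ℝ) - (Gabcke.a t - ((N : ℤ) : ℝ)) * ((2 : ℤ) : ℝ) = Gabcke.z t := by
            unfold Gabcke.z; rw [hNeq]; push_cast; ring
          rwa [e1] at this
        obtain ⟨hcos, hF⟩ := mem_FBox hR hz hFI
        -- (i) the main sum
        have hmainBox : MI.mem X.R.T.S (2 * (Complex.exp ((θm : ℂ) * I) * Wsum N t).re)
            ((MC.mul X.R.T.S E W).re.mulInt 2) := by
          have := MI.mem_mulInt (MC.mem_mul hS hE' hW').1 2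
          convert this using 1
          push_cast; ring
        have hmain : MI.mem X.R.T.S (Gabcke.mainSum t)
            (((MC.mul X.R.T.S E W).re.mulInt 2).widen (Numerics.cdiv (2 * dl.hi * W.absHi) X.R.T.S)) := by
          apply MI.mem_widen hmainBox
          have hθ := abs_riemannSiegelTheta_sub_stirling_le (t := t) (by linarith)
          rw [← hθm] at hθ
          have h1 := abs_two_re_sub_le' (riemannSiegelTheta t) θm (Wsum N t)
          have hWn := MC.norm_le_absHi hW'
          have hd2 := hdl'.2
          have hδ0 : 0 ≤ 2 * stirlingVertRate (1 / 4) / t := by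
            unfold stirlingVertRate; positivity
          have hdlhi : (0 : ℝ) ≤ dl.hi := le_trans (by positivity) hd2
          have hprod : (2 * stirlingVertRate (1 / 4) / t * X.R.T.S) * (‖Wsum N t‖ * X.R.T.S) ≤
              (dl.hi : ℝ) * W.absHi := mul_le_mul hd2 hWn (by positivity) hdlhi
          have hkey : |Gabcke.mainSum t - 2 * (Complex.exp ((θm : ℂ) * I) * Wsum N t).re| * X.R.T.S ≤
              2 * (dl.hi : ℝ) * W.absHi / X.R.T.S := by
            rw [mainSum_eq_re, hNeq, le_div_iff₀ hSr]
            calc |2 * (Complex.exp ((riemannSiegelTheta t : ℂ) * I) * Wsum N t).re -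
                  2 * (Complex.exp ((θm : ℂ) * I) * Wsum N t).re| * X.R.T.S * X.R.T.S
                ≤ 2 * |riemannSiegelTheta t - θm| * ‖Wsum N t‖ * X.R.T.S * X.R.T.S := by gcongr
              _ ≤ 2 * (2 * stirlingVertRate (1 / 4) / t) * ‖Wsum N t‖ * X.R.T.S * X.R.T.S := by gcongr
              _ = 2 * ((2 * stirlingVertRate (1 / 4) / t * X.R.T.S) * (‖Wsum N t‖ * X.R.T.S)) := by ring
              _ ≤ 2 * ((dl.hi : ℝ) * W.absHi) := by linarith [hprod]
              _ = 2 * (dl.hi : ℝ) * W.absHi := by ring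
          have hc := Numerics.div_le_cdiv (a := 2 * dl.hi * W.absHi) (b := (X.R.T.S : ℤ))
            (by exact_mod_cast hS)
          push_cast at hc
          exact hkey.trans hc
        -- (ii) the `C₀` term
        have hc0 : MI.mem X.R.T.S ((-1 : ℝ) ^ (N + 1) * Gabcke.F (Gabcke.z t) / Real.sqrt (Gabcke.a t))
            ((MI.mul X.R.T.S ainv FI).mulInt ((-1) ^ (N + 1))) := by
          have := MI.mem_mulInt (MI.mem_mul hS hainv' hF) ((-1) ^ (N + 1))
          convert this using 1
          push_cast
          rw [div_eq_mul_inv]; ring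
        -- (iii) the proved remainder bound, in interval arithmetic
        have hw := MI.mem_mul hS hainv' hainv'
        have hw2 := MI.mem_mul hS hw hw
        have hw3 := MI.mem_mul hS hw2 hw
        have hw4 := MI.mem_mul hS hw3 hw
        have hw5 := MI.mem_mul hS hw4 hw
        have hg := MI.mem_mul hS hainv' (MI.mem_add (MI.mem_add (MI.mem_add (MI.mem_add (MI.mem_add
          (MI.mem_mul hS hX.mem_c1 hw) (MI.mem_mul hS hX.mem_c2 hw2)) (MI.mem_mul hS hX.mem_c3 hw3))
          (MI.mem_mul hS hX.mem_c4 hw4)) (MI.mem_mul hS hX.mem_c5 hw5)) (MI.mem_mul hS hdl' hX.mem_cθ))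
        set g := MI.mul X.R.T.S ainv ((((((MI.mul X.R.T.S X.c1 (MI.mul X.R.T.S ainv ainv)).add
            (MI.mul X.R.T.S X.c2 (MI.mul X.R.T.S (MI.mul X.R.T.S ainv ainv) (MI.mul X.R.T.S ainv ainv)))).add
            (MI.mul X.R.T.S X.c3 (MI.mul X.R.T.S (MI.mul X.R.T.S (MI.mul X.R.T.S ainv ainv)
              (MI.mul X.R.T.S ainv ainv)) (MI.mul X.R.T.S ainv ainv)))).add
            (MI.mul X.R.T.S X.c4 (MI.mul X.R.T.S (MI.mul X.R.T.S (MI.mul X.R.T.S (MI.mul X.R.T.S ainv ainv)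
              (MI.mul X.R.T.S ainv ainv)) (MI.mul X.R.T.S ainv ainv)) (MI.mul X.R.T.S ainv ainv)))).add
            (MI.mul X.R.T.S X.c5 (MI.mul X.R.T.S (MI.mul X.R.T.S (MI.mul X.R.T.S (MI.mul X.R.T.S
              (MI.mul X.R.T.S ainv ainv) (MI.mul X.R.T.S ainv ainv)) (MI.mul X.R.T.S ainv ainv))
              (MI.mul X.R.T.S ainv ainv)) (MI.mul X.R.T.S ainv ainv)))).add
            (MI.mul X.R.T.S dl X.cθ)) with hgdef
        have hbound := Gabcke.abs_R0_le_cpoly (t := t) (by linarith)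
          (by rw [htdef]; exact Gabcke.int_ne_a_dyadic hp1) hcos
        have hR0 : MI.mem X.R.T.S (Gabcke.R0 t) ⟨-g.hi, g.hi⟩ := by
          have hgS := hg.2
          have habs : |Gabcke.R0 t| * X.R.T.S ≤ (g.hi : ℝ) :=
            le_trans (mul_le_mul_of_nonneg_right hbound hSr.le) hgS
          have habs' : |Gabcke.R0 t * X.R.T.S| ≤ (g.hi : ℝ) := by
            rw [abs_mul, abs_of_pos hSr]; exact habs
          have h2 := abs_le.1 habs'
          refine ⟨?_, h2.2⟩
          push_cast
          exact h2.1
        -- assemble `Z = main + C₀-term + R₀`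
        have hsum := MI.mem_add (MI.mem_add hmain hc0) hR0
        have e1 : hardyZ t = Gabcke.mainSum t +
            (-1 : ℝ) ^ (N + 1) * Gabcke.F (Gabcke.z t) / Real.sqrt (Gabcke.a t) + Gabcke.R0 t := by
          unfold Gabcke.R0; rw [hNeq]; ring
        rw [e1]
        exact hsum
      · simp at h
    · simp at h
  · simp at h

end Soundness

end RSEval

end Literature.NumberTheory.LFunctions
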